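/-
Copyright (c) 2026. All rights reserved.
Released under Apache 2.0 license as described in the file LICENSE.
-/
import Literature.NumberTheory.ComplexMultiplication.DegenerateCMTypesCyclicPrimePower
import Literature.AlgebraicGeometry.Pohlmann1968.DegenerateCMTypesCyclicCMFieldPrimeSquare
import Mathlib.RingTheory.ZMod.UnitsCyclic
import HarnessLib

/-!
# CM fields with Galois group `⟨ρ⟩ × ℤ_{p^k}`: an exceptional Hodge class for each level of equidistribution,
# the dichotomy for simple abelian `p^k`-folds, `ℚ(ζ₈₁)`

Number-field ∕ abelian-variety dress of `NumberTheory/ComplexMultiplication/DegenerateCMTypesCyclicPrimePower`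
(the ranks of the CM types of the cyclic group of order `2p^k` by LEVELS OF EQUIDISTRIBUTION), in the pattern of
`Pohlmann1968/DegenerateCMTypesCyclicCMFieldPrimeSquare` (the case `k = 2`, Dodson's dimension `9`), whose
balanced-set construction is generalised from "constant coset counts" to "coset counts of period `p^i`".
THEOREMS ONLY (no definition, no named fact, no `sorry`).

## The print

B. Dodson, *On the Mumford–Tate group of an abelian variety with complex multiplication*, J. Algebra **111** (1987)
[Dodson1987] (held text `paper:doi-10-1016-0021-8693-87-90242-0`, pp. 69–71), §4.1, Prop. 4.4 (1) (`⟨ρ⟩ × ℤ₉`: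
"the orbits of order `9` give types with rank(`f`) `= 8` or `10`"), Remark 4.5 ("simple Abelian varieties of
dimension `n = 18, 27, 36, 54`, and `72` with rank `10`").  F. Hazama, *Hodge cycles on abelian varieties with
complex multiplication by cyclic CM-fields*, J. Math. Sci. Univ. Tokyo **10** (2003) [Hazama2003CyclicCM]: Thm. 4.8
(iv) and §5 (the kernel elements `w^{(d)}` of weight a proper divisor: balanced sets made of cosets), Rem. 4.10
("Lenstra: if `A` is degenerate and the CM field is abelian, `A` itself supports a nondivisorial Hodge cycle").
B. B. Gordon [Gordon1999HodgeAVSurvey], 9.2.2 (Pohlmann ∕ White: a Galois-balanced set of `2m` embeddings not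
closed under conjugation gives, on a simple `A`, a Hodge `(m,m)`-class outside `Dᵐ`), Thm. 6.4 ∕ §9.3
(nondegenerate ⟹ `Hdg(Aⁿ) = Div(Aⁿ)` for all `n`).

## Setting

`K` a CM field, normal over `ℚ` with COMMUTATIVE Galois group, `φ₀` a base embedding, `ρ` the complex conjugation
(`φ₀ ∘ ρ = conj ∘ φ₀`), `σ ∈ Gal(K/ℚ)` of order `p^k`, `[K : ℚ] = 2p^k`, `p` odd: `Gal(K/ℚ) = ⟨ρ⟩ × ⟨σ⟩`
(`rho_not_mem_zpowers`); every CM field with CYCLIC Galois group of order `2p^k` is of this kind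
(`exists_orderOf_eq_pow`; §4), e.g. `ℚ(ζ₈₁)` (§5), `ℚ(ζ₁₆₃)`, `ℚ(ζ₂₄₃)`.  A CM type `Φ` is read on the group as
`{g : σ_g = φ₀ ∘ g⁻¹ ∈ Φ}`; "equidistributed at level `i + 1`" (`i < k`) = the counts
`N(c) = rowCount (p^{k−i−1}) (p^{i+1}) {g : σ_g ∈ Φ} (σ^{p^{i+1}}) σ c` on the cosets `σᶜ⟨σ^{p^{i+1}}⟩` satisfy
`N(c + p^i) = N(c)`; level `k` = `σ^{p^{k−1}}`-stable = not primitive.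

## What is proved

* §0 (group level, digits `ℤ/A × ℤ/B` for `σ` of order `AB`): `card_hazamaSet` (`2A`), **`isBalanced_hazamaSet`**
  (`Δ(y, y+d) = σʸ⟨σ^B⟩ ∪ ρσ^{y+d}⟨σ^B⟩` is balanced whenever the coset counts have period `d` — the carry of the
  digit addition is absorbed in the coset), `exists_mem_hazamaSet_rho_mul_not_mem`.
* §1 the frame: `rho_not_mem_zpowers`, `card_gal_eq`, `finrank_div_two_eq`, `exists_orderOf_eq_pow`.
* §2 types: **`cmTypeRank_add_defect_eq`** (`Rank + Σ_{i<k} φ(p^{i+1})[level i+1] = p^k + 1`),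
  **`isNondegenerate_iff`** (no level), **`isPrimitive_iff_not_isStableUnder`** (`σ^{p^{k−1}}`),
  `le_cmTypeRank_of_isPrimitive` (`≥ φ(p^k) + 2`), `cmTypeRank_le_of_not_isPrimitive` (`≤ p^{k−1} + 1`),
  **`isPrimitive_iff_lt_cmTypeRank`**.
* §3 abelian varieties: `dim_eq` (`p^k`), `isSimple_iff`, `isSimple_iff_lt_cmTypeRank`,
  **`exists_exceptional_of_level`** (no non-trivial stabiliser + level `i + 1` ⟹ a rational
  `(p^{k−i−1}, p^{k−i−1})`-class on `A` outside `D^{p^{k−i−1}}(A) ⊗ ℂ`),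
  **`hodgeConjectureFor_pow_or_exceptional_of_isSimple`** (simple `A`: nondegenerate with the Hodge conjecture for
  all powers, OR degenerate with an explicit exceptional class of codimension `p^{k−i−1} ≥ p` on `A` itself),
  `hodgeConjectureFor_pow_of_isSimple_of_forall_not_exceptional`.
* §4 coordinate-free, `Gal(K/ℚ)` cyclic of order `2p^k`: `isPrimitive_iff_of_isCyclic`,
  **`hodgeConjectureFor_pow_or_exceptional_of_isCyclic`**.
* §5 degree `54`: **`cmTypeRank_mem_of_isCyclic_fiftyFour`** (simple ⟹ rank `∈ {28, 26, 22, 20}`, non-simple ⟹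
  `∈ {10, 8, 4, 2}`), **`hodgeConjectureFor_pow_or_exceptional_of_isCyclic_fiftyFour`** (rank `28` and HC for all
  powers, or rank `∈ {26, 22, 20}` with a rational `(9,9)`- or `(3,3)`-class outside `D`),
  `cm_normal_cyclic_finrank_eightyOne`, **`hodgeConjectureFor_pow_or_exceptional_eightyOne`** (`ℚ(ζ₈₁)`).

NOT here: existence of types at each level (counts), non-simple `A` (induced from the subfield of degree
`2p^{k−1}`, whose type may itself be degenerate for `k ≥ 3`).

## References

* [Dodson1987] B. Dodson, J. Algebra 111 (1987) 49–73: §4.1 Prop. 4.1, Prop. 4.4 (1), Remark 4.5; Thm. 1.12.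
* [Hazama2003CyclicCM] F. Hazama, J. Math. Sci. Univ. Tokyo 10 (2003): Prop. 2.3, Thm. 4.8, Rem. 4.10, §5.
* [Kubota1965] T. Kubota, Trans. AMS 118 (1965), §4 Lemma 2.
* [Gordon1999HodgeAVSurvey] B. B. Gordon, 9.2.2, Thm. 6.4, §9.3, 9.4.
* [Pohlmann1968] H. Pohlmann, Ann. of Math. 88 (1968), Thm. 1 and §3.
* [Shimura1998] G. Shimura, *Abelian varieties with complex multiplication and modular functions*, §6.2 Thm. 3,
  §8.1, §8.2 Prop. 26, §18.2.
* [Washington1997] L. Washington, *Introduction to cyclotomic fields*, Thm. 2.5.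

## Provenance

Lane `lit-hodgefound` (Track 2, Layer A3 — CM types), seat `lit-hodgefound-p10` generation 35, row g35-#10;
neighbours cited by name, nothing restated: `DegenerateCMTypesCyclicPrimePower` (levels, ranks, stabilisers),
`Pohlmann1968/DegenerateCMTypesCyclicCMFieldTwoOddPrimes` (generic §1: `isCMTypeWith_galType`,
`cmTypeRank_eq_typeRank_galType`, `isPrimitive_iff`, `isSimple_iff`, `separating_of_forall_not_isStableUnder`),
`MumfordSimpleFourfoldOfPrimitive` (`exists_exceptional_iff_of_primitive`), `DegenerateCMTypesCyclicTwoOddPrimes`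
(`hazamaSet`, `rowCount`, `isBalanced_indicator_iff`).
-/

open scoped BigOperators NumberField IsMulCommutative Classical
open CategoryTheory NumberField

namespace Literature.AlgebraicGeometry.Pohlmann1968

namespace CyclicPrimePower

open Literature.NumberTheory.ComplexMultiplication
open Literature.NumberTheory.ComplexMultiplication.CyclicCMType
open Literature.NumberTheory.ComplexMultiplication.CyclicCMType.PrimePow

/-! ## §0 Group level: the balanced sets `σ^{y}⟨σ^B⟩ ∪ ρσ^{y+d}⟨σ^B⟩` of a type whose coset counts have period `d` -/

section Balanced

variable {G : Type*} [CommGroup G] [Fintype G] [DecidableEq G] {A B : ℕ} [hA : NeZero A] [hB : NeZero B]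
  {ρ σ : G} {Φ : Finset G}

omit [Fintype G] [DecidableEq G] hA hB in
/-- `(σ^B)ˣ σʸ = σ^{Bx + y}`. [folklore] -/
private theorem pow_pow_mul_pow (x y : ℕ) : (σ ^ B) ^ x * σ ^ y = σ ^ (B * x + y) := by
  rw [← pow_mul, ← pow_add]

omit [Fintype G] [DecidableEq G] hA hB in
/-- In `⟨ρ⟩ × ⟨σ⟩` no `ρσ^{Bx+y}` is a `σ^{Bx'+y'}`. [folklore] -/
private theorem rho_mul_ne (hρσ : ρ ∉ Subgroup.zpowers σ) (x y x' y' : ℕ) :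
    ρ * ((σ ^ B) ^ x * σ ^ y) ≠ (σ ^ B) ^ x' * σ ^ y' := by
  rw [pow_pow_mul_pow, pow_pow_mul_pow]
  intro h
  apply hρσ
  have : ρ = σ ^ (B * x' + y') * (σ ^ (B * x + y))⁻¹ := by rw [← h, mul_inv_cancel_right]
  rw [this]
  exact mul_mem (pow_mem (Subgroup.mem_zpowers σ) _) (inv_mem (pow_mem (Subgroup.mem_zpowers σ) _))

omit [Fintype G] [DecidableEq G] hA in
/-- `σ^B` has order `A` for `σ` of order `AB`. [folklore] -/
private theorem orderOf_pow_eq (hσ : orderOf σ = A * B) : orderOf (σ ^ B) = A := by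
  rw [orderOf_pow' σ (NeZero.ne B), hσ, Nat.gcd_eq_right (dvd_mul_left B A),
    Nat.mul_div_cancel _ (Nat.pos_of_ne_zero (NeZero.ne B))]

omit [Fintype G] [DecidableEq G] in
/-- `x ↦ σ^{Bx+y}` is injective on `ℤ/A` (fixed `y`). [folklore] -/
private theorem pow_pow_mul_pow_injective_left (hσ : orderOf σ = A * B) (y : ZMod B) :
    Function.Injective fun x : ZMod A => (σ ^ B) ^ x.val * σ ^ y.val := by
  intro x x' h
  have h' : (σ ^ B) ^ x.val = (σ ^ B) ^ x'.val := mul_right_cancel h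
  rw [pow_eq_pow_iff_modEq, orderOf_pow_eq hσ] at h'
  have := Nat.ModEq.eq_of_lt_of_lt h' (ZMod.val_lt x) (ZMod.val_lt x')
  exact ZMod.val_injective A this

omit [Fintype G] [DecidableEq G] in
/-- `x ↦ ρσ^{Bx+y}` is injective on `ℤ/A` (fixed `y`). [folklore] -/
private theorem rho_mul_pow_pow_mul_pow_injective_left (hσ : orderOf σ = A * B) (y : ZMod B) :
    Function.Injective fun x : ZMod A => ρ * ((σ ^ B) ^ x.val * σ ^ y.val) := fun _ _ h =>
  pow_pow_mul_pow_injective_left hσ y (mul_left_cancel h)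

omit [Fintype G] hB in
/-- The two halves of `Δ(y₁, y₂) = σ^{y₁}⟨σ^B⟩ ∪ ρσ^{y₂}⟨σ^B⟩` are disjoint. [folklore] -/
private theorem disjoint_parts (hρσ : ρ ∉ Subgroup.zpowers σ) (y₁ y₂ : ZMod B) :
    Disjoint (Finset.univ.image fun x : ZMod A => (σ ^ B) ^ x.val * σ ^ y₁.val)
      (Finset.univ.image fun x : ZMod A => ρ * ((σ ^ B) ^ x.val * σ ^ y₂.val)) := by
  rw [Finset.disjoint_left]
  intro d hd hd'
  obtain ⟨x, -, rfl⟩ := Finset.mem_image.1 hd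
  obtain ⟨x', -, he⟩ := Finset.mem_image.1 hd'
  exact rho_mul_ne hρσ _ _ _ _ he

omit [Fintype G] in
/-- **`#Δ(y₁, y₂) = 2A`** for the tree's `hazamaSet A ρ (σ^B) σ y₁ y₂ = σ^{y₁}⟨σ^B⟩ ∪ ρσ^{y₂}⟨σ^B⟩`
(`σ` of order `AB`; weight `A = |⟨σ^B⟩|`). [cite: Hazama2003CyclicCM, §5] -/
theorem card_hazamaSet (hσ : orderOf σ = A * B) (hρσ : ρ ∉ Subgroup.zpowers σ) (y₁ y₂ : ZMod B) :
    (hazamaSet A ρ (σ ^ B) σ y₁ y₂).card = 2 * A := by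
  unfold hazamaSet
  rw [Finset.card_union_of_disjoint (disjoint_parts hρσ y₁ y₂),
    Finset.card_image_of_injective _ (pow_pow_mul_pow_injective_left hσ y₁),
    Finset.card_image_of_injective _ (rho_mul_pow_pow_mul_pow_injective_left hσ y₂), Finset.card_univ,
    ZMod.card, two_mul]

omit [Fintype G] [DecidableEq G] in
/-- **Translating a coset in the digits** (the carry): for `a ∈ ℤ/A`, `b, y ∈ ℤ/B` there is a shift `s ∈ ℤ/A`
with `σ^{Ba+b} · σ^{Bx+y} = σ^{B(x+s) + (y+b)}` for all `x` (`s = a +` the carry of `y + b`). [folklore] -/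
private theorem exists_shift (hσ : orderOf σ = A * B) (a : ZMod A) (b y : ZMod B) :
    ∃ s : ZMod A, ∀ x : ZMod A,
      (σ ^ B) ^ a.val * σ ^ b.val * ((σ ^ B) ^ x.val * σ ^ y.val) = (σ ^ B) ^ (x + s).val * σ ^ (y + b).val := by
  set e : ℕ := (y.val + b.val) / B with he
  refine ⟨a + (e : ZMod A), fun x => ?_⟩
  have hyb : σ ^ y.val * σ ^ b.val = (σ ^ B) ^ e * σ ^ (y + b).val := by
    rw [← pow_add, ZMod.val_add, ← pow_mul, ← pow_add, he, Nat.div_add_mod]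
  have hmod : (x + (a + (e : ZMod A))).val ≡ x.val + a.val + e [MOD A] := by
    rw [ZMod.val_add]
    refine (Nat.mod_modEq _ _).trans ?_
    rw [ZMod.val_add, ZMod.val_natCast, add_assoc]
    exact (Nat.ModEq.refl _).add ((Nat.mod_modEq _ _).trans ((Nat.ModEq.refl _).add (Nat.mod_modEq _ _)))
  have hpow : (σ ^ B) ^ (x + (a + (e : ZMod A))).val = (σ ^ B) ^ (x.val + a.val + e) := by
    rw [pow_eq_pow_iff_modEq, orderOf_pow_eq hσ]
    exact hmod
  rw [hpow]
  calc (σ ^ B) ^ a.val * σ ^ b.val * ((σ ^ B) ^ x.val * σ ^ y.val)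
      = (σ ^ B) ^ a.val * (σ ^ B) ^ x.val * (σ ^ y.val * σ ^ b.val) := by
        simp only [mul_assoc, mul_comm, mul_left_comm]
    _ = (σ ^ B) ^ (x.val + a.val + e) * σ ^ (y + b).val := by
        rw [hyb, pow_add, pow_add]
        simp only [mul_assoc, mul_comm]

omit [Fintype G] hB in
/-- Shifting the index of a row count. [folklore] -/
private theorem card_filter_add_eq (a : ZMod A) (P : ZMod A → Prop) [DecidablePred P] :
    (Finset.univ.filter fun x : ZMod A => P (x + a)).card = (Finset.univ.filter P).card := by
  refine Finset.card_bij (fun x _ => x + a) (fun x hx => ?_) (fun x _ x' _ h => add_right_cancel h)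
    fun x hx => ⟨x - a, ?_, sub_add_cancel x a⟩
  · exact Finset.mem_filter.2 ⟨Finset.mem_univ _, (Finset.mem_filter.1 hx).2⟩
  · refine Finset.mem_filter.2 ⟨Finset.mem_univ _, ?_⟩
    rw [sub_add_cancel]; exact (Finset.mem_filter.1 hx).2

omit [Fintype G] hB in
/-- Complementary row count: `#{x : σ^{Bx+y} ∉ S} = A − #{x : σ^{Bx+y} ∈ S}`. [folklore] -/
private theorem card_filter_not_mem_row (Φ : Finset G) (y : ZMod B) :
    (Finset.univ.filter fun x : ZMod A => (σ ^ B) ^ x.val * σ ^ y.val ∉ Φ).card =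
      A - rowCount A B Φ (σ ^ B) σ y := by
  unfold rowCount
  have := Finset.card_filter_add_card_filter_not
    (s := (Finset.univ : Finset (ZMod A))) (fun x : ZMod A => (σ ^ B) ^ x.val * σ ^ y.val ∈ Φ)
  rw [Finset.card_univ, ZMod.card] at this
  omega

/-- **`Δ(y, y + d) = σʸ⟨σ^B⟩ ∪ ρσ^{y+d}⟨σ^B⟩` is a balanced weight for every type whose coset counts
`N(c) = #(S ∩ σᶜ⟨σ^B⟩)` have period `d`** (Pohlmann's condition `#(gΔ ∩ S) = A` for all `g`: a translate `σᶜ⟨σ^B⟩`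
meets `S` in `N(c)` points, a translate `ρσ^{c+d}⟨σ^B⟩` in `A − N(c + d) = A − N(c)`) — Hazama's kernel elements
`w^{(d)}` of §5, on `⟨ρ⟩ × ℤ_{AB}`. [cite: Hazama2003CyclicCM, §5 (5.1)–(5.3)] [cite: Gordon1999HodgeAVSurvey, §9.2 (9.2.1)] -/
theorem isBalanced_hazamaSet (hσ : orderOf σ = A * B) (hρσ : ρ ∉ Subgroup.zpowers σ)
    (hcard : Fintype.card G = 2 * (A * B)) (h : IsCMTypeWith ρ (Φ : Set G)) {d : ZMod B}
    (hN : ∀ c : ZMod B, rowCount A B Φ (σ ^ B) σ (c + d) = rowCount A B Φ (σ ^ B) σ c) (y₁ : ZMod B) :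
    IsBalanced G (Φ : Set G) (fun e => if e ∈ hazamaSet A ρ (σ ^ B) σ y₁ (y₁ + d) then (1 : ℚ) else 0) := by
  have hρ2 : ρ * ρ = 1 := by
    have := h.invol (1 : G)
    simpa [smul_eq_mul] using this
  rw [isBalanced_indicator_iff, card_hazamaSet hσ hρσ]
  intro g
  have hle : ∀ y, rowCount A B Φ (σ ^ B) σ y ≤ A := fun y => rowCount_le A B Φ (σ ^ B) σ y
  have hcount1 : ∀ (a : ZMod A) (b y : ZMod B),
      ((Finset.univ.image fun x : ZMod A => (σ ^ B) ^ x.val * σ ^ y.val).filter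
        fun e => (σ ^ B) ^ a.val * σ ^ b.val * e ∈ Φ).card = rowCount A B Φ (σ ^ B) σ (y + b) := by
    intro a b y
    obtain ⟨s, hs⟩ := exists_shift hσ a b y
    rw [Finset.filter_image, Finset.card_image_of_injective _ (pow_pow_mul_pow_injective_left hσ y)]
    simp_rw [hs]
    rw [card_filter_add_eq s (fun x : ZMod A => (σ ^ B) ^ x.val * σ ^ (y + b).val ∈ Φ)]
    rfl
  have hcount2 : ∀ (a : ZMod A) (b y : ZMod B),
      ((Finset.univ.image fun x : ZMod A => (σ ^ B) ^ x.val * σ ^ y.val).filter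
        fun e => ρ * ((σ ^ B) ^ a.val * σ ^ b.val) * e ∈ Φ).card = A - rowCount A B Φ (σ ^ B) σ (y + b) := by
    intro a b y
    obtain ⟨s, hs⟩ := exists_shift hσ a b y
    rw [Finset.filter_image, Finset.card_image_of_injective _ (pow_pow_mul_pow_injective_left hσ y)]
    simp_rw [mul_assoc ρ, hs, rho_mul_mem_iff h]
    rw [card_filter_add_eq s (fun x : ZMod A => (σ ^ B) ^ x.val * σ ^ (y + b).val ∉ Φ),
      card_filter_not_mem_row Φ (y + b)]
  have hcount3 : ∀ (a : ZMod A) (b y : ZMod B),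
      ((Finset.univ.image fun x : ZMod A => ρ * ((σ ^ B) ^ x.val * σ ^ y.val)).filter
        fun e => (σ ^ B) ^ a.val * σ ^ b.val * e ∈ Φ).card = A - rowCount A B Φ (σ ^ B) σ (y + b) := by
    intro a b y
    obtain ⟨s, hs⟩ := exists_shift hσ a b y
    rw [Finset.filter_image, Finset.card_image_of_injective _ (rho_mul_pow_pow_mul_pow_injective_left hσ y)]
    simp_rw [mul_left_comm _ ρ, hs, rho_mul_mem_iff h]
    rw [card_filter_add_eq s (fun x : ZMod A => (σ ^ B) ^ x.val * σ ^ (y + b).val ∉ Φ),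
      card_filter_not_mem_row Φ (y + b)]
  have hcount4 : ∀ (a : ZMod A) (b y : ZMod B),
      ((Finset.univ.image fun x : ZMod A => ρ * ((σ ^ B) ^ x.val * σ ^ y.val)).filter
        fun e => ρ * ((σ ^ B) ^ a.val * σ ^ b.val) * e ∈ Φ).card = rowCount A B Φ (σ ^ B) σ (y + b) := by
    intro a b y
    obtain ⟨s, hs⟩ := exists_shift hσ a b y
    rw [Finset.filter_image, Finset.card_image_of_injective _ (rho_mul_pow_pow_mul_pow_injective_left hσ y)]
    have hρρ : ∀ x : ZMod A, ρ * ((σ ^ B) ^ a.val * σ ^ b.val) * (ρ * ((σ ^ B) ^ x.val * σ ^ y.val)) =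
        (σ ^ B) ^ (x + s).val * σ ^ (y + b).val := fun x => by
      rw [← hs]
      calc ρ * ((σ ^ B) ^ a.val * σ ^ b.val) * (ρ * ((σ ^ B) ^ x.val * σ ^ y.val))
          = ρ * ρ * ((σ ^ B) ^ a.val * σ ^ b.val * ((σ ^ B) ^ x.val * σ ^ y.val)) := by
            simp only [mul_assoc, mul_left_comm]
        _ = (σ ^ B) ^ a.val * σ ^ b.val * ((σ ^ B) ^ x.val * σ ^ y.val) := by rw [hρ2, one_mul]
    simp_rw [hρρ]
    rw [card_filter_add_eq s (fun x : ZMod A => (σ ^ B) ^ x.val * σ ^ (y + b).val ∈ Φ)]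
    rfl
  have hper : ∀ b : ZMod B, rowCount A B Φ (σ ^ B) σ (y₁ + d + b) = rowCount A B Φ (σ ^ B) σ (y₁ + b) := by
    intro b
    rw [add_right_comm]
    exact hN (y₁ + b)
  obtain ⟨⟨a, b⟩, rfl | rfl⟩ := PrimePow.exists_coord hσ hρσ hcard g
  · unfold hazamaSet
    dsimp only
    rw [Finset.filter_union, Finset.card_union_of_disjoint
      ((disjoint_parts hρσ y₁ (y₁ + d)).mono (Finset.filter_subset _ _) (Finset.filter_subset _ _)),
      hcount1, hcount3, hper]
    have := hle (y₁ + b)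
    omega
  · unfold hazamaSet
    dsimp only
    rw [Finset.filter_union, Finset.card_union_of_disjoint
      ((disjoint_parts hρσ y₁ (y₁ + d)).mono (Finset.filter_subset _ _) (Finset.filter_subset _ _)),
      hcount2, hcount4, hper]
    have := hle (y₁ + b)
    omega

/-- **`Δ(y₁, y₂)` is not conjugation-symmetric for `y₁ ≠ y₂`** (`σ^{y₁} ∈ Δ`, `ρσ^{y₁} ∉ Δ`: height one).
[cite: Hazama2003CyclicCM, §5] -/
theorem exists_mem_hazamaSet_rho_mul_not_mem (hσ : orderOf σ = A * B) (hρσ : ρ ∉ Subgroup.zpowers σ)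
    (hcard : Fintype.card G = 2 * (A * B)) {y₁ y₂ : ZMod B} (hy : y₁ ≠ y₂) :
    ∃ e ∈ hazamaSet A ρ (σ ^ B) σ y₁ y₂, ρ * e ∉ hazamaSet A ρ (σ ^ B) σ y₁ y₂ := by
  refine ⟨(σ ^ B) ^ (0 : ZMod A).val * σ ^ y₁.val, ?_, ?_⟩
  · unfold hazamaSet
    exact Finset.mem_union_left _ (Finset.mem_image.2 ⟨0, Finset.mem_univ _, rfl⟩)
  · unfold hazamaSet
    rw [Finset.mem_union, not_or]
    constructor
    · intro hm
      obtain ⟨x, -, he⟩ := Finset.mem_image.1 hm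
      exact rho_mul_ne hρσ _ _ _ _ he.symm
    · intro hm
      obtain ⟨x, -, he⟩ := Finset.mem_image.1 hm
      have hinj := (PrimePow.coord_bijective hσ hρσ hcard).1
        (a₁ := Sum.inl (x, y₂)) (a₂ := Sum.inl (0, y₁)) (mul_left_cancel he)
      simp only [Sum.inl.injEq, Prod.mk.injEq] at hinj
      exact hy hinj.2.symm

end Balanced

/-! ## §1 The frame on `Gal(K/ℚ)` for a CM field with commutative Galois group of order `2p^k` -/

open Literature.AlgebraicGeometry.Motives (AbelianVariety CMType)
open Literature.AlgebraicGeometry.HodgeTheory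
open Literature.AlgebraicGeometry.VanGeemen1994 (hodgeClassSpan)
open Literature.AlgebraicGeometry.ComplexMultiplication (IsCMTypeRealisation isSimple_iff_isPrimitive
  isPrimitive_ringEquiv_complex_iff exists_isCMTypeRealisation)
open Literature.Barriers.HodgeConjecture (divisorClassesSpan)
open Literature.AlgebraicGeometry.Pohlmann1968.CyclicTwoOddPrimes (gal_comm isCMTypeWith_galType
  cmTypeRank_eq_typeRank_galType mem_galType_iff exists_cmType_of_isCMTypeWith separating_of_forall_not_isStableUnder)

section Frame

variable {K : Type} [Field K] [NumberField K] [Normal ℚ K] [IsMulCommutative (K ≃ₐ[ℚ] K)]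
variable {p : ℕ} [hp : Fact p.Prime] {k : ℕ} {ρ σ : K ≃ₐ[ℚ] K} {φ₀ : K →+* ℂ}

omit [Normal ℚ K] [IsMulCommutative (K ≃ₐ[ℚ] K)] in
/-- **`ρ ∉ ⟨σ⟩`**: the complex conjugation has order `2`, the subgroup `⟨σ⟩` has odd order `p^k` — so
`Gal(K/ℚ) = ⟨ρ⟩ × ⟨σ⟩ ≅ ⟨ρ⟩ × ℤ_{p^k}`. [cite: Dodson1987, §4.1] [cite: Shimura1998, §18.2 Lemma (i)] -/
theorem rho_not_mem_zpowers [IsCMField K] (hp2 : p ≠ 2) (hρ : ∀ x, φ₀ (ρ x) = starRingEnd ℂ (φ₀ x))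
    (hσ : orderOf σ = p ^ k) : ρ ∉ Subgroup.zpowers σ := by
  intro hmem
  have hρ1 := conjGalElt_ne_one hρ
  have hρ2 := conjGalElt_mul_self hρ
  have hdvd : orderOf ρ ∣ p ^ k := by rw [← hσ]; exact orderOf_dvd_of_mem_zpowers hmem
  haveI : Fact (Nat.Prime 2) := ⟨Nat.prime_two⟩
  have ho : orderOf ρ = 2 := orderOf_eq_prime (by rw [sq, hρ2]) hρ1
  rw [ho] at hdvd
  have h2p : 2 ∣ p := Nat.Prime.dvd_of_dvd_pow Nat.prime_two hdvd
  exact hp2 ((Nat.prime_dvd_prime_iff_eq Nat.prime_two hp.out).1 h2p).symm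

omit [IsMulCommutative (K ≃ₐ[ℚ] K)] hp in
/-- `|Gal(K/ℚ)| = 2p^k`. [cite: Shimura1998, §8.1] -/
theorem card_gal_eq (φ₀ : K →+* ℂ) (hK : Module.finrank ℚ K = 2 * p ^ k) :
    Fintype.card (K ≃ₐ[ℚ] K) = 2 * p ^ k := by
  rw [card_gal_eq_finrank φ₀, hK]

omit [Normal ℚ K] [IsMulCommutative (K ≃ₐ[ℚ] K)] hp in
/-- `[K : ℚ]/2 = p^k` (`= dim A`). [cite: Shimura1998, §6.2 Theorem 3] -/
theorem finrank_div_two_eq (hK : Module.finrank ℚ K = 2 * p ^ k) : Module.finrank ℚ K / 2 = p ^ k := by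
  rw [hK, Nat.mul_div_cancel_left _ two_pos]

omit [IsMulCommutative (K ≃ₐ[ℚ] K)] hp in
/-- **A CYCLIC Galois group of order `2p^k` contains an element of order `p^k`** (the square of a generator).
[cite: Dodson1987, §4.1] -/
theorem exists_orderOf_eq_pow (hcyc : IsCyclic (K ≃ₐ[ℚ] K)) (φ₀ : K →+* ℂ) (hK : Module.finrank ℚ K = 2 * p ^ k) :
    ∃ σ : K ≃ₐ[ℚ] K, orderOf σ = p ^ k := by
  obtain ⟨γ, hγgen⟩ := hcyc.exists_generator
  have hγ : orderOf γ = 2 * p ^ k := by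
    rw [orderOf_eq_card_of_forall_mem_zpowers hγgen, Nat.card_eq_fintype_card, card_gal_eq φ₀ hK]
  refine ⟨γ ^ 2, ?_⟩
  rw [orderOf_pow' γ two_ne_zero, hγ, Nat.gcd_eq_right (dvd_mul_right 2 (p ^ k)), Nat.mul_div_cancel_left _ two_pos]

end Frame

/-! ## §2 The CM types of `K`: ranks by levels, nondegeneracy, primitivity -/

section Types

variable {K : Type} [Field K] [NumberField K] [IsCMField K] [Normal ℚ K] [IsMulCommutative (K ≃ₐ[ℚ] K)]
variable {p : ℕ} [hp : Fact p.Prime] {k : ℕ} {ρ σ : K ≃ₐ[ℚ] K} {φ₀ : K →+* ℂ}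

/-- **RANK PLUS DEFECT `= p^k + 1`** for every CM type `Φ` of `K`: `Rank(Φ) + Σ_{i<k} φ(p^{i+1})·[the Galois-level
type `{g : σ_g ∈ Φ}` is equidistributed at level `i + 1`] `= p^k + 1`, where "equidistributed at level `i + 1`"
means: the counts `N(c) = #{g ∈ σᶜ⟨σ^{p^{i+1}}⟩ : σ_g ∈ Φ}` on the cosets of `⟨σ^{p^{i+1}}⟩` satisfy
`N(c + p^i) = N(c)`. [cite: Kubota1965, §4 Lemma 2] [cite: Dodson1987, Prop. 4.4 (1)] [cite: Hazama2003CyclicCM, Thm. 4.8] -/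
theorem cmTypeRank_add_defect_eq (hp2 : p ≠ 2) (hρ : ∀ x, φ₀ (ρ x) = starRingEnd ℂ (φ₀ x))
    (hσ : orderOf σ = p ^ k) (hK : Module.finrank ℚ K = 2 * p ^ k) (Φ : CMType K) :
    cmTypeRank Φ +
        ∑ i ∈ Finset.range k,
          (if (∀ c : ZMod (p ^ (i + 1)),
              rowCount (p ^ (k - (i + 1))) (p ^ (i + 1)) (Finset.univ.filter fun g : K ≃ₐ[ℚ] K => embOf φ₀ g ∈ Φ.1)
                  (σ ^ p ^ (i + 1)) σ (c + (p ^ i : ℕ)) =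
                rowCount (p ^ (k - (i + 1))) (p ^ (i + 1)) (Finset.univ.filter fun g : K ≃ₐ[ℚ] K => embOf φ₀ g ∈ Φ.1)
                  (σ ^ p ^ (i + 1)) σ c)
            then p ^ (i + 1) - p ^ i else 0) = p ^ k + 1 := by
  rw [cmTypeRank_eq_typeRank_galType Φ φ₀]
  exact PrimePow.typeRank_add_defect_eq hp2 hσ (rho_not_mem_zpowers hp2 hρ hσ) (card_gal_eq φ₀ hK)
    (isCMTypeWith_galType hρ Φ)

/-- **NONDEGENERACY CRITERION**: `Φ` is nondegenerate iff its Galois-level type is equidistributed at NO level.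
[cite: Kubota1965, §4 Lemma 2] [cite: Dodson1987, Prop. 4.4 (1)] [cite: Hazama2003CyclicCM, Thm. 4.8 (i)] -/
theorem isNondegenerate_iff (hp2 : p ≠ 2) (hρ : ∀ x, φ₀ (ρ x) = starRingEnd ℂ (φ₀ x))
    (hσ : orderOf σ = p ^ k) (hK : Module.finrank ℚ K = 2 * p ^ k) (Φ : CMType K) :
    IsNondegenerate Φ ↔ ∀ i < k,
      ¬ ∀ c : ZMod (p ^ (i + 1)),
        rowCount (p ^ (k - (i + 1))) (p ^ (i + 1)) (Finset.univ.filter fun g : K ≃ₐ[ℚ] K => embOf φ₀ g ∈ Φ.1)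
            (σ ^ p ^ (i + 1)) σ (c + (p ^ i : ℕ)) =
          rowCount (p ^ (k - (i + 1))) (p ^ (i + 1)) (Finset.univ.filter fun g : K ≃ₐ[ℚ] K => embOf φ₀ g ∈ Φ.1)
            (σ ^ p ^ (i + 1)) σ c := by
  rw [_root_.Literature.AlgebraicGeometry.Pohlmann1968.isNondegenerate_iff, cmTypeRank_eq_typeRank_galType Φ φ₀,
    finrank_div_two_eq hK]
  exact PrimePow.typeRank_eq_iff hp2 hσ (rho_not_mem_zpowers hp2 hρ hσ) (card_gal_eq φ₀ hK)
    (isCMTypeWith_galType hρ Φ)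

/-- **PRIMITIVITY CRITERION** (`k = i₀ + 1 ≥ 1`): `Φ` is primitive (Shimura §8.2 Prop. 26, at any base embedding)
iff its Galois-level type is NOT stable under `σ^{p^{k−1}}` (the subgroup of order `p`): not induced from the
subfield of index `p`. [cite: Dodson1987, Prop. 4.1 (proof)] [cite: Hazama2003CyclicCM, Prop. 2.3]
[cite: Shimura1998, §8.2 Prop. 26] -/
theorem isPrimitive_iff_not_isStableUnder (hp2 : p ≠ 2) (hρ : ∀ x, φ₀ (ρ x) = starRingEnd ℂ (φ₀ x)) {i₀ : ℕ}
    (hσ : orderOf σ = p ^ (i₀ + 1)) (hK : Module.finrank ℚ K = 2 * p ^ (i₀ + 1)) (Φ : CMType K)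
    (φh : K →+* ℂ) :
    IsPrimitive (ℂ ≃+* ℂ) Φ.1 φh ↔
      ¬ IsStableUnder (Finset.univ.filter fun g : K ≃ₐ[ℚ] K => embOf φ₀ g ∈ Φ.1) (σ ^ p ^ i₀) := by
  rw [CyclicTwoOddPrimes.isPrimitive_iff (φ₀ := φ₀) Φ φh]
  have := PrimePow.forall_not_isStableUnder_iff hp2 hσ (Nat.le_add_left 1 i₀) (rho_not_mem_zpowers hp2 hρ hσ)
    (card_gal_eq φ₀ hK) (isCMTypeWith_galType hρ Φ)
  rwa [Nat.add_sub_cancel] at this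

/-- **Primitive types have rank `≥ φ(p^k) + 2 = p^k − p^{k−1} + 2`.** [cite: Dodson1987, Prop. 4.4 (1) and Thm. 1.12]
[cite: Kubota1965, §4 Lemma 2] -/
theorem le_cmTypeRank_of_isPrimitive (hp2 : p ≠ 2) (hρ : ∀ x, φ₀ (ρ x) = starRingEnd ℂ (φ₀ x)) {i₀ : ℕ}
    (hσ : orderOf σ = p ^ (i₀ + 1)) (hK : Module.finrank ℚ K = 2 * p ^ (i₀ + 1)) (Φ : CMType K)
    {φh : K →+* ℂ} (hprim : IsPrimitive (ℂ ≃+* ℂ) Φ.1 φh) :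
    p ^ (i₀ + 1) - p ^ i₀ + 2 ≤ cmTypeRank Φ := by
  rw [cmTypeRank_eq_typeRank_galType Φ φ₀]
  exact PrimePow.le_typeRank_of_primitive hp2 hσ (rho_not_mem_zpowers hp2 hρ hσ) (card_gal_eq φ₀ hK)
    (isCMTypeWith_galType hρ Φ) ((CyclicTwoOddPrimes.isPrimitive_iff (φ₀ := φ₀) Φ φh).1 hprim)

/-- **Imprimitive types have rank `≤ p^{k−1} + 1`.** [cite: Dodson1987, Prop. 4.4 (1)] [cite: Kubota1965, §4 Lemma 2] -/
theorem cmTypeRank_le_of_not_isPrimitive (hp2 : p ≠ 2) (hρ : ∀ x, φ₀ (ρ x) = starRingEnd ℂ (φ₀ x)) {i₀ : ℕ}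
    (hσ : orderOf σ = p ^ (i₀ + 1)) (hK : Module.finrank ℚ K = 2 * p ^ (i₀ + 1)) (Φ : CMType K)
    {φh : K →+* ℂ} (hnp : ¬ IsPrimitive (ℂ ≃+* ℂ) Φ.1 φh) : cmTypeRank Φ ≤ p ^ i₀ + 1 := by
  rw [cmTypeRank_eq_typeRank_galType Φ φ₀]
  rw [CyclicTwoOddPrimes.isPrimitive_iff (φ₀ := φ₀) Φ φh] at hnp
  obtain ⟨u, hu1, hu⟩ : ∃ u : K ≃ₐ[ℚ] K, u ≠ 1 ∧
      IsStableUnder (Finset.univ.filter fun g : K ≃ₐ[ℚ] K => embOf φ₀ g ∈ Φ.1) u := by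
    by_contra hcon
    exact hnp fun u hu1 hu => hcon ⟨u, hu1, hu⟩
  exact PrimePow.typeRank_le_of_not_primitive hp2 hσ (rho_not_mem_zpowers hp2 hρ hσ) (card_gal_eq φ₀ hK)
    (isCMTypeWith_galType hρ Φ) ⟨u, hu1, hu⟩

/-- **`Φ` is primitive iff `Rank(Φ) > p^{k−1} + 1`.** [cite: Dodson1987, Prop. 4.4 (1)] -/
theorem isPrimitive_iff_lt_cmTypeRank (hp2 : p ≠ 2) (hρ : ∀ x, φ₀ (ρ x) = starRingEnd ℂ (φ₀ x)) {i₀ : ℕ}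
    (hσ : orderOf σ = p ^ (i₀ + 1)) (hK : Module.finrank ℚ K = 2 * p ^ (i₀ + 1)) (Φ : CMType K)
    (φh : K →+* ℂ) : IsPrimitive (ℂ ≃+* ℂ) Φ.1 φh ↔ p ^ i₀ + 1 < cmTypeRank Φ := by
  rw [CyclicTwoOddPrimes.isPrimitive_iff (φ₀ := φ₀) Φ φh, cmTypeRank_eq_typeRank_galType Φ φ₀]
  exact PrimePow.primitive_iff_lt_typeRank hp2 hσ (rho_not_mem_zpowers hp2 hρ hσ) (card_gal_eq φ₀ hK)
    (isCMTypeWith_galType hρ Φ)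

end Types

/-! ## §3 Abelian varieties of type `(K; Φ)`: an exceptional Hodge class for each level of equidistribution -/

section AbelianVarieties

variable {K : Type} [Field K] [NumberField K] [IsCMField K] [Normal ℚ K] [IsMulCommutative (K ≃ₐ[ℚ] K)]
variable {p : ℕ} [hp : Fact p.Prime] {k : ℕ} {ρ σ : K ≃ₐ[ℚ] K} {φ₀ : K →+* ℂ}
variable {Φ : CMType K} {A : AbelianVariety ℂ} {ι : 𝓞 K →+* End A} {θ : K →+* Module.End ℂ (complexBetti A.X 1)}

omit [IsCMField K] [Normal ℚ K] [IsMulCommutative (K ≃ₐ[ℚ] K)] hp in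
/-- **`dim A = p^k`.** [cite: Shimura1998, §6.2 Theorem 3] -/
theorem dim_eq (hK : Module.finrank ℚ K = 2 * p ^ k) (hA : IsCMTypeRealisation Φ A ι θ) : A.dim = p ^ k :=
  dim_eq_blockType hK hA

/-- **`A` is simple iff the Galois-level type is not `σ^{p^{k−1}}`-stable.** [cite: Shimura1998, §8.2 Prop. 26]
[cite: Dodson1987, Prop. 4.1 (proof)] -/
theorem isSimple_iff (hp2 : p ≠ 2) (hρ : ∀ x, φ₀ (ρ x) = starRingEnd ℂ (φ₀ x)) {i₀ : ℕ}
    (hσ : orderOf σ = p ^ (i₀ + 1)) (hK : Module.finrank ℚ K = 2 * p ^ (i₀ + 1)) (hA : IsCMTypeRealisation Φ A ι θ) :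
    A.IsSimple ↔ ¬ IsStableUnder (Finset.univ.filter fun g : K ≃ₐ[ℚ] K => embOf φ₀ g ∈ Φ.1) (σ ^ p ^ i₀) := by
  rw [isSimple_iff_isPrimitive hA φ₀, isPrimitive_iff_not_isStableUnder hp2 hρ hσ hK Φ φ₀]

/-- **`A` is simple iff `Rank > p^{k−1} + 1`.** [cite: Dodson1987, Prop. 4.4 (1)] [cite: Shimura1998, §8.2 Prop. 26] -/
theorem isSimple_iff_lt_cmTypeRank (hp2 : p ≠ 2) (hρ : ∀ x, φ₀ (ρ x) = starRingEnd ℂ (φ₀ x)) {i₀ : ℕ}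
    (hσ : orderOf σ = p ^ (i₀ + 1)) (hK : Module.finrank ℚ K = 2 * p ^ (i₀ + 1)) (hA : IsCMTypeRealisation Φ A ι θ) :
    A.IsSimple ↔ p ^ i₀ + 1 < cmTypeRank Φ := by
  rw [isSimple_iff_isPrimitive hA φ₀, isPrimitive_iff_lt_cmTypeRank hp2 hρ hσ hK Φ φ₀]

/-- **AN EXCEPTIONAL HODGE CLASS OF CODIMENSION `p^{k−i−1}` ON `A` FOR EACH LEVEL OF EQUIDISTRIBUTION.**  If the
Galois-level type of `Φ` has no non-trivial stabiliser (`A` simple) and is equidistributed at level `i + 1`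
(`i < k`), then every abelian variety `A` of type `(K; Φ)` carries a rational `(m,m)`-class OUTSIDE `Dᵐ(A) ⊗ ℂ`,
`m = p^{k−i−1} = |⟨σ^{p^{i+1}}⟩|`: the set `Δ = {σ_g : g ∈ ⟨σ^{p^{i+1}}⟩} ∪ {σ_g : g ∈ ρσ^{p^i}⟨σ^{p^{i+1}}⟩}` of `2m`
embeddings is Galois-balanced (`isBalanced_hazamaSet`) and contains `σ_1` but not `σ̄_1`, so Pohlmann's criterion
(`exists_exceptional_iff_of_primitive`) applies.  Level `1` (`i = 0`, `m = p^{k−1}`) is Hazama's "`p`-dominated"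
mechanism; for `k = 2` this is the `(p,p)`-class of `DegenerateCMTypesCyclicCMFieldPrimeSquare`.
[cite: Hazama2003CyclicCM, Thm. 4.8 (iv), §5 and Rem. 4.10] [cite: Gordon1999HodgeAVSurvey, 9.2.2]
[cite: Pohlmann1968, Thm. 1 and §3] [cite: Dodson1987, Prop. 4.4 (1)] -/
theorem exists_exceptional_of_level (hp2 : p ≠ 2) (hρ : ∀ x, φ₀ (ρ x) = starRingEnd ℂ (φ₀ x))
    (hσ : orderOf σ = p ^ k) (hK : Module.finrank ℚ K = 2 * p ^ k)
    (hprim : ∀ u : K ≃ₐ[ℚ] K, u ≠ 1 →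
      ¬ IsStableUnder (Finset.univ.filter fun g : K ≃ₐ[ℚ] K => embOf φ₀ g ∈ Φ.1) u)
    {i : ℕ} (hi : i < k)
    (hL : ∀ c : ZMod (p ^ (i + 1)),
      rowCount (p ^ (k - (i + 1))) (p ^ (i + 1)) (Finset.univ.filter fun g : K ≃ₐ[ℚ] K => embOf φ₀ g ∈ Φ.1)
          (σ ^ p ^ (i + 1)) σ (c + (p ^ i : ℕ)) =
        rowCount (p ^ (k - (i + 1))) (p ^ (i + 1)) (Finset.univ.filter fun g : K ≃ₐ[ℚ] K => embOf φ₀ g ∈ Φ.1)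
          (σ ^ p ^ (i + 1)) σ c)
    (hA : IsCMTypeRealisation Φ A ι θ) :
    ∃ c : complexBetti A.X (2 * p ^ (k - (i + 1))), IsRationalClass c ∧
      IsOfHodgeType (p ^ k) A.X (2 * p ^ (k - (i + 1))) (p ^ (k - (i + 1))) (p ^ (k - (i + 1))) c ∧
        c ∉ divisorClassesSpan A.X (p ^ k) (p ^ (k - (i + 1))) := by
  have hρσ := rho_not_mem_zpowers hp2 hρ hσ
  have hσ' : orderOf σ = p ^ (k - (i + 1)) * p ^ (i + 1) := by rw [hσ, ← pow_add, Nat.sub_add_cancel hi]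
  have hcardG : Fintype.card (K ≃ₐ[ℚ] K) = 2 * (p ^ (k - (i + 1)) * p ^ (i + 1)) := by
    rw [card_gal_eq φ₀ hK, ← pow_add, Nat.sub_add_cancel hi]
  have h := isCMTypeWith_galType hρ Φ
  have hinj := (embOf_bijective φ₀).1
  have hd : (0 : ZMod (p ^ (i + 1))) ≠ 0 + ((p ^ i : ℕ) : ZMod (p ^ (i + 1))) := by
    rw [zero_add, ne_comm, Ne, ZMod.natCast_eq_zero_iff]
    intro hdvd
    have := Nat.le_of_dvd (pow_pos hp.out.pos i) hdvd
    have hlt : p ^ i < p ^ (i + 1) := Nat.pow_lt_pow_right hp.out.one_lt (Nat.lt_succ_self i)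
    omega
  -- the balanced set `Δ(0, p^i)` on the Galois group and its image in `Hom(K, ℂ)`
  set ΔG : Finset (K ≃ₐ[ℚ] K) :=
    hazamaSet (p ^ (k - (i + 1))) ρ (σ ^ p ^ (i + 1)) σ (0 : ZMod (p ^ (i + 1)))
      (0 + ((p ^ i : ℕ) : ZMod (p ^ (i + 1)))) with hΔG
  set Δ : Finset (K →+* ℂ) := ΔG.image (embOf φ₀) with hΔ
  have hcard : Δ.card = 2 * p ^ (k - (i + 1)) := by
    rw [hΔ, Finset.card_image_of_injective _ hinj, hΔG, card_hazamaSet hσ' hρσ]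
  have hbalG := (isBalanced_indicator_iff (Finset.univ.filter fun g : K ≃ₐ[ℚ] K => embOf φ₀ g ∈ Φ.1) ΔG).1
    (isBalanced_hazamaSet hσ' hρσ hcardG h hL 0)
  have hbal : IsGaloisBalanced Φ Δ := by
    rw [isGaloisBalanced_iff_two_mul]
    intro γ
    obtain ⟨δ, hδ⟩ := exists_algEquiv_comp_eq_smul φ₀ γ
    have hset : {s : K →+* ℂ | s ∈ Δ ∧ (γ : ℂ →+* ℂ).comp s ∈ Φ.1} =
        ↑((ΔG.filter fun d => δ⁻¹ * d ∈
          (Finset.univ.filter fun g : K ≃ₐ[ℚ] K => embOf φ₀ g ∈ Φ.1)).image (embOf φ₀)) := by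
      ext s
      simp only [Set.mem_setOf_eq, Finset.coe_image, Finset.coe_filter, Set.mem_image, hΔ, Finset.mem_image]
      constructor
      · rintro ⟨⟨d, hd, rfl⟩, hs⟩
        refine ⟨d, ⟨hd, ?_⟩, rfl⟩
        rw [mem_galType_iff, mul_comm, ← smul_embOf_of_comp φ₀ hδ, ringEquiv_smul_def]
        exact hs
      · rintro ⟨d, ⟨hd, hd'⟩, rfl⟩
        refine ⟨⟨d, hd, rfl⟩, ?_⟩
        rw [mem_galType_iff, mul_comm, ← smul_embOf_of_comp φ₀ hδ, ringEquiv_smul_def] at hd'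
        exact hd'
    rw [hset, Set.ncard_coe_finset, Finset.card_image_of_injective _ hinj, hcard, ← card_hazamaSet hσ' hρσ 0 _]
    exact hbalG δ⁻¹
  have hns : ∃ φ ∈ Δ, ComplexEmbedding.conjugate φ ∉ Δ := by
    obtain ⟨d, hdm, hnd⟩ := exists_mem_hazamaSet_rho_mul_not_mem hσ' hρσ hcardG hd
    refine ⟨embOf φ₀ d, Finset.mem_image_of_mem _ hdm, fun hc => hnd ?_⟩
    rw [conjugate_embOf gal_comm hρ, hΔ, Finset.mem_image] at hc
    obtain ⟨d', hd', he⟩ := hc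
    rw [← hinj he]
    exact hd'
  have key := (exists_exceptional_iff_of_primitive hA (separating_of_forall_not_isStableUnder Φ hprim)
    (p ^ (k - (i + 1)))).2 ⟨Δ, ⟨hcard, hbal⟩, hns⟩
  rwa [finrank_div_two_eq hK] at key

/-- **THE DICHOTOMY FOR SIMPLE ABELIAN VARIETIES with complex multiplication by a CM field with Galois group
`⟨ρ⟩ × ℤ_{p^k}`** (`p` odd): for `A` simple of type `(K; Φ)` (dimension `p^k`), EITHER `Φ` is nondegenerate and
`B•(Aⁿ) ⊗ ℂ = D•(Aⁿ) ⊗ ℂ` with the Hodge conjecture for every power `Aⁿ`, OR the Galois-level type is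
equidistributed at some level `i + 1 < k` and `A` ITSELF carries a rational `(m,m)`-class outside `Dᵐ(A) ⊗ ℂ`,
`m = p^{k−i−1} ≥ p` (Lenstra's remark for abelian CM fields, made explicit). [cite: Hazama2003CyclicCM, Rem. 4.10 and Thm. 4.8]
[cite: Gordon1999HodgeAVSurvey, Thm. 6.4, §9.3 and 9.2.2] [cite: Dodson1987, Prop. 4.4 (1)] -/
theorem hodgeConjectureFor_pow_or_exceptional_of_isSimple (hp2 : p ≠ 2)
    (hρ : ∀ x, φ₀ (ρ x) = starRingEnd ℂ (φ₀ x)) (hσ : orderOf σ = p ^ k) (hK : Module.finrank ℚ K = 2 * p ^ k)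
    (Φ : CMType K) (hA : IsCMTypeRealisation Φ A ι θ) (hs : A.IsSimple) :
    (IsNondegenerate Φ ∧
      (∀ n m : ℕ, hodgeClassSpan (⨁ fun _ : Fin n => A).dim (⨁ fun _ : Fin n => A).X m =
        divisorClassesSpan (⨁ fun _ : Fin n => A).X (⨁ fun _ : Fin n => A).dim m) ∧
      ∀ n : ℕ, HodgeConjectureFor (⨁ fun _ : Fin n => A).dim (⨁ fun _ : Fin n => A).X) ∨
    (¬ IsNondegenerate Φ ∧ ∃ i : ℕ, i + 1 < k ∧
      ∃ c : complexBetti A.X (2 * p ^ (k - (i + 1))), IsRationalClass c ∧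
        IsOfHodgeType (p ^ k) A.X (2 * p ^ (k - (i + 1))) (p ^ (k - (i + 1))) (p ^ (k - (i + 1))) c ∧
          c ∉ divisorClassesSpan A.X (p ^ k) (p ^ (k - (i + 1)))) := by
  have hprim := (CyclicTwoOddPrimes.isSimple_iff φ₀ hA).1 hs
  by_cases hnd : IsNondegenerate Φ
  · exact Or.inl ⟨hnd, fun n m => hnd.hodgeClassSpan_pow_eq_divisorClassesSpan hA n m,
      fun n => hnd.hodgeConjectureFor_pow hA n⟩
  · right
    refine ⟨hnd, ?_⟩
    rw [isNondegenerate_iff hp2 hρ hσ hK Φ] at hnd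
    obtain ⟨i, hi, hL⟩ : ∃ i, i < k ∧ ∀ c : ZMod (p ^ (i + 1)),
        rowCount (p ^ (k - (i + 1))) (p ^ (i + 1)) (Finset.univ.filter fun g : K ≃ₐ[ℚ] K => embOf φ₀ g ∈ Φ.1)
            (σ ^ p ^ (i + 1)) σ (c + (p ^ i : ℕ)) =
          rowCount (p ^ (k - (i + 1))) (p ^ (i + 1)) (Finset.univ.filter fun g : K ≃ₐ[ℚ] K => embOf φ₀ g ∈ Φ.1)
            (σ ^ p ^ (i + 1)) σ c := by
      by_contra hcon
      exact hnd fun i hi hL => hcon ⟨i, hi, hL⟩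
    -- the level is not the top one: the top level is stability under `σ^{p^{k−1}}`, excluded by primitivity
    have hik : i + 1 < k := by
      rcases Nat.lt_or_ge (i + 1) k with hlt | hge
      · exact hlt
      · exfalso
        have hk : k = i + 1 := le_antisymm hge hi
        subst hk
        have hcardG : Fintype.card (K ≃ₐ[ℚ] K) = 2 * p ^ (i + 1) := card_gal_eq φ₀ hK
        have hst := (level_top_iff_isStableUnder hσ (rho_not_mem_zpowers hp2 hρ hσ) hcardG
          (isCMTypeWith_galType hρ Φ)).1 hL
        have hne : σ ^ p ^ i ≠ 1 := by
          have := PrimePow.forall_not_isStableUnder_iff hp2 hσ (Nat.le_add_left 1 i)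
            (rho_not_mem_zpowers hp2 hρ hσ) hcardG (isCMTypeWith_galType hρ Φ)
          rw [Nat.add_sub_cancel] at this
          exact fun h1 => (this.1 hprim) (by rw [h1]; exact fun g => by rw [one_mul])
        exact hprim _ hne hst
    exact ⟨i, hik, exists_exceptional_of_level hp2 hρ hσ hK hprim hi hL hA⟩

/-- **For SIMPLE `A`: the Hodge conjecture for all powers of `A` as soon as NO rational `(m,m)`-class outside `Dᵐ`
exists on `A` for the `m = p^{k−i−1}`, `i + 1 < k`** (contrapositive packaging of the dichotomy).
[cite: Hazama2003CyclicCM, Rem. 4.10] [cite: Gordon1999HodgeAVSurvey, Thm. 6.4 and 9.2.2] -/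
theorem hodgeConjectureFor_pow_of_isSimple_of_forall_not_exceptional (hp2 : p ≠ 2)
    (hρ : ∀ x, φ₀ (ρ x) = starRingEnd ℂ (φ₀ x)) (hσ : orderOf σ = p ^ k) (hK : Module.finrank ℚ K = 2 * p ^ k)
    (Φ : CMType K) (hA : IsCMTypeRealisation Φ A ι θ) (hs : A.IsSimple)
    (hno : ∀ i : ℕ, i + 1 < k → ∀ c : complexBetti A.X (2 * p ^ (k - (i + 1))), IsRationalClass c →
      IsOfHodgeType (p ^ k) A.X (2 * p ^ (k - (i + 1))) (p ^ (k - (i + 1))) (p ^ (k - (i + 1))) c →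
        c ∈ divisorClassesSpan A.X (p ^ k) (p ^ (k - (i + 1)))) (n : ℕ) :
    HodgeConjectureFor (⨁ fun _ : Fin n => A).dim (⨁ fun _ : Fin n => A).X := by
  rcases hodgeConjectureFor_pow_or_exceptional_of_isSimple hp2 hρ hσ hK Φ hA hs with ⟨-, -, h⟩ | ⟨-, i, hi, c, hc⟩
  · exact h n
  · exact absurd (hno i hi c hc.1 hc.2.1) hc.2.2

end AbelianVarieties

/-! ## §4 CM fields with CYCLIC Galois group of order `2p^k`: the statements free of coordinates -/

section Cyclic

open Literature.AlgebraicGeometry.ComplexMultiplication.CyclicTwoPower (exists_conj_gal)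

variable {K : Type} [Field K] [NumberField K] [IsCMField K] [Normal ℚ K] {p k : ℕ}
variable {Φ : CMType K} {A : AbelianVariety ℂ} {ι : 𝓞 K →+* End A} {θ : K →+* Module.End ℂ (complexBetti A.X 1)}

omit [IsCMField K] [Normal ℚ K] in
/-- A cyclic Galois group is commutative. [folklore] -/
private theorem comm_of_isCyclic (hcyc : IsCyclic (K ≃ₐ[ℚ] K)) : ∀ g h : K ≃ₐ[ℚ] K, g * h = h * g := by
  obtain ⟨γ, hγ⟩ := hcyc.exists_generator
  intro g h
  obtain ⟨m, rfl⟩ := Subgroup.mem_zpowers_iff.1 (hγ g)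
  obtain ⟨n, rfl⟩ := Subgroup.mem_zpowers_iff.1 (hγ h)
  rw [← zpow_add, ← zpow_add, add_comm]

/-- **For every CM field with CYCLIC Galois group of order `2p^k` (`p` odd, `k ≥ 1`): a CM type is primitive iff its
rank exceeds `p^{k−1} + 1`, and then its rank is at least `φ(p^k) + 2`.** [cite: Dodson1987, Prop. 4.4 (1)]
[cite: Kubota1965, §4 Lemma 2] -/
theorem isPrimitive_iff_of_isCyclic (hcyc : IsCyclic (K ≃ₐ[ℚ] K)) (hp : p.Prime) (hp2 : p ≠ 2) {i₀ : ℕ}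
    (hK : Module.finrank ℚ K = 2 * p ^ (i₀ + 1)) (Φ : CMType K) (φh : K →+* ℂ) :
    (IsPrimitive (ℂ ≃+* ℂ) Φ.1 φh ↔ p ^ i₀ + 1 < cmTypeRank Φ) ∧
      (IsPrimitive (ℂ ≃+* ℂ) Φ.1 φh → p ^ (i₀ + 1) - p ^ i₀ + 2 ≤ cmTypeRank Φ) := by
  haveI : Fact p.Prime := ⟨hp⟩
  haveI : IsMulCommutative (K ≃ₐ[ℚ] K) := ⟨⟨comm_of_isCyclic hcyc⟩⟩
  obtain ⟨ρ, hρall⟩ := exists_conj_gal (K := K)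
  have hρ := hρall φh
  obtain ⟨σ, hσ⟩ := exists_orderOf_eq_pow hcyc φh hK
  exact ⟨isPrimitive_iff_lt_cmTypeRank hp2 hρ hσ hK Φ φh, fun hprim =>
    le_cmTypeRank_of_isPrimitive hp2 hρ hσ hK Φ hprim⟩

/-- **THE DICHOTOMY for every CM field with cyclic Galois group of order `2p^k`, simple `A`.**
[cite: Hazama2003CyclicCM, Rem. 4.10 and Thm. 4.8] [cite: Gordon1999HodgeAVSurvey, Thm. 6.4, §9.3 and 9.2.2]
[cite: Dodson1987, Prop. 4.4 (1)] -/
theorem hodgeConjectureFor_pow_or_exceptional_of_isCyclic (hcyc : IsCyclic (K ≃ₐ[ℚ] K)) (hp : p.Prime)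
    (hp2 : p ≠ 2) (hK : Module.finrank ℚ K = 2 * p ^ k) (Φ : CMType K) (hA : IsCMTypeRealisation Φ A ι θ)
    (hs : A.IsSimple) :
    (IsNondegenerate Φ ∧
      (∀ n m : ℕ, hodgeClassSpan (⨁ fun _ : Fin n => A).dim (⨁ fun _ : Fin n => A).X m =
        divisorClassesSpan (⨁ fun _ : Fin n => A).X (⨁ fun _ : Fin n => A).dim m) ∧
      ∀ n : ℕ, HodgeConjectureFor (⨁ fun _ : Fin n => A).dim (⨁ fun _ : Fin n => A).X) ∨
    (¬ IsNondegenerate Φ ∧ ∃ i : ℕ, i + 1 < k ∧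
      ∃ c : complexBetti A.X (2 * p ^ (k - (i + 1))), IsRationalClass c ∧
        IsOfHodgeType (p ^ k) A.X (2 * p ^ (k - (i + 1))) (p ^ (k - (i + 1))) (p ^ (k - (i + 1))) c ∧
          c ∉ divisorClassesSpan A.X (p ^ k) (p ^ (k - (i + 1)))) := by
  haveI : Fact p.Prime := ⟨hp⟩
  haveI : IsMulCommutative (K ≃ₐ[ℚ] K) := ⟨⟨comm_of_isCyclic hcyc⟩⟩
  obtain ⟨φ₀⟩ := (inferInstance : Nonempty (K →+* ℂ))
  obtain ⟨ρ, hρall⟩ := exists_conj_gal (K := K)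
  have hρ := hρall φ₀
  obtain ⟨σ, hσ⟩ := exists_orderOf_eq_pow hcyc φ₀ hK
  exact hodgeConjectureFor_pow_or_exceptional_of_isSimple hp2 hρ hσ hK Φ hA hs

end Cyclic

/-! ## §5 `p^k = 27`: the cyclic CM fields of degree `54`, and `ℚ(ζ₈₁)` -/

section TwentySeven

open Polynomial (cyclotomic)
open Literature.AlgebraicGeometry.ComplexMultiplication.CyclicTwoPower (exists_conj_gal)

variable {K : Type} [Field K] [NumberField K] [IsCMField K] [Normal ℚ K]
variable {Φ : CMType K} {A : AbelianVariety ℂ} {ι : 𝓞 K →+* End A} {θ : K →+* Module.End ℂ (complexBetti A.X 1)}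

/-- **CM fields with cyclic Galois group of order `54`: a simple abelian `27`-fold of type `(K; Φ)` has
`Rank(Φ) ∈ {28, 26, 22, 20}`; a non-simple one `Rank(Φ) ∈ {10, 8, 4, 2}`.** [cite: Dodson1987, Prop. 4.4 (1) and Remark 4.5]
[cite: Kubota1965, §4 Lemma 2] -/
theorem cmTypeRank_mem_of_isCyclic_fiftyFour (hcyc : IsCyclic (K ≃ₐ[ℚ] K)) (hK : Module.finrank ℚ K = 54)
    (Φ : CMType K) (hA : IsCMTypeRealisation Φ A ι θ) :
    (A.IsSimple → cmTypeRank Φ ∈ ({28, 26, 22, 20} : Finset ℕ)) ∧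
      (¬ A.IsSimple → cmTypeRank Φ ∈ ({10, 8, 4, 2} : Finset ℕ)) := by
  haveI : IsMulCommutative (K ≃ₐ[ℚ] K) := ⟨⟨comm_of_isCyclic hcyc⟩⟩
  obtain ⟨φ₀⟩ := (inferInstance : Nonempty (K →+* ℂ))
  obtain ⟨ρ, hρall⟩ := exists_conj_gal (K := K)
  have hρ := hρall φ₀
  have hK' : Module.finrank ℚ K = 2 * 3 ^ 3 := by rw [hK]; norm_num
  obtain ⟨σ, hσ⟩ := exists_orderOf_eq_pow (p := 3) hcyc φ₀ hK'
  have hσ27 : orderOf σ = 27 := by rw [hσ]; norm_num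
  have hρσ := rho_not_mem_zpowers (p := 3) (by norm_num) hρ hσ
  have hcardG : Fintype.card (K ≃ₐ[ℚ] K) = 54 := by rw [card_gal_eq_finrank φ₀, hK]
  have h := isCMTypeWith_galType hρ Φ
  rw [CyclicTwoOddPrimes.isSimple_iff φ₀ hA, cmTypeRank_eq_typeRank_galType Φ φ₀]
  refine ⟨fun hprim => typeRank_mem_of_primitive_twentySeven hσ27 hρσ hcardG h hprim, fun hnp => ?_⟩
  obtain ⟨u, hu1, hu⟩ : ∃ u : K ≃ₐ[ℚ] K, u ≠ 1 ∧
      IsStableUnder (Finset.univ.filter fun g : K ≃ₐ[ℚ] K => embOf φ₀ g ∈ Φ.1) u := by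
    by_contra hcon
    exact hnp fun u hu1 hu => hcon ⟨u, hu1, hu⟩
  exact typeRank_mem_of_not_primitive_twentySeven hσ27 hρσ hcardG h ⟨u, hu1, hu⟩

/-- **CM fields with cyclic Galois group of order `54`, simple `A` (dimension `27`): rank `28` and the Hodge
conjecture for all powers of `A`; or rank `∈ {26, 22, 20}` and a rational `(9,9)`- or `(3,3)`-class on `A` outside
`D⁹(A) ⊗ ℂ`, resp. `D³(A) ⊗ ℂ`.** [cite: Dodson1987, Prop. 4.4 (1) and Remark 4.5] [cite: Hazama2003CyclicCM, Rem. 4.10]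
[cite: Gordon1999HodgeAVSurvey, Thm. 6.4 and 9.2.2] -/
theorem hodgeConjectureFor_pow_or_exceptional_of_isCyclic_fiftyFour (hcyc : IsCyclic (K ≃ₐ[ℚ] K))
    (hK : Module.finrank ℚ K = 54) (Φ : CMType K) (hA : IsCMTypeRealisation Φ A ι θ) (hs : A.IsSimple) :
    (cmTypeRank Φ = 28 ∧
      (∀ n m : ℕ, hodgeClassSpan (⨁ fun _ : Fin n => A).dim (⨁ fun _ : Fin n => A).X m =
        divisorClassesSpan (⨁ fun _ : Fin n => A).X (⨁ fun _ : Fin n => A).dim m) ∧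
      ∀ n : ℕ, HodgeConjectureFor (⨁ fun _ : Fin n => A).dim (⨁ fun _ : Fin n => A).X) ∨
    (cmTypeRank Φ ∈ ({26, 22, 20} : Finset ℕ) ∧
      ((∃ c : complexBetti A.X 18, IsRationalClass c ∧ IsOfHodgeType 27 A.X 18 9 9 c ∧
          c ∉ divisorClassesSpan A.X 27 9) ∨
        ∃ c : complexBetti A.X 6, IsRationalClass c ∧ IsOfHodgeType 27 A.X 6 3 3 c ∧
          c ∉ divisorClassesSpan A.X 27 3)) := by
  have hK' : Module.finrank ℚ K = 2 * 3 ^ 3 := by rw [hK]; norm_num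
  have hmem := (cmTypeRank_mem_of_isCyclic_fiftyFour hcyc hK Φ hA).1 hs
  have hnd_iff : IsNondegenerate Φ ↔ cmTypeRank Φ = 28 := by
    rw [_root_.Literature.AlgebraicGeometry.Pohlmann1968.isNondegenerate_iff, hK]
  rcases hodgeConjectureFor_pow_or_exceptional_of_isCyclic hcyc Nat.prime_three (by norm_num) hK' Φ hA hs with
    ⟨hnd, h1, h2⟩ | ⟨hnd, i, hi, c, hc⟩
  · exact Or.inl ⟨hnd_iff.1 hnd, h1, h2⟩
  · right
    rw [hnd_iff] at hnd
    refine ⟨?_, ?_⟩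
    · simp only [Finset.mem_insert, Finset.mem_singleton] at hmem ⊢
      omega
    · have hi1 : i ≤ 1 := by omega
      interval_cases i
      · left; exact ⟨c, hc⟩
      · right; exact ⟨c, hc⟩

/-- **`ℚ(ζ₈₁)`**: CM, normal, cyclic Galois group (`(ℤ/81)ˣ` is cyclic), degree `φ(81) = 54 = 2·27`.
[cite: Washington1997, Thm. 2.5] -/
theorem cm_normal_cyclic_finrank_eightyOne (L : Type) [Field L] [NumberField L]
    [IsCyclotomicExtension {81} ℚ L] :
    IsCMField L ∧ Normal ℚ L ∧ IsCyclic (L ≃ₐ[ℚ] L) ∧ Module.finrank ℚ L = 54 := by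
  have hirr : Irreducible (cyclotomic 81 ℚ) := cyclotomic.irreducible_rat (by norm_num)
  haveI := IsCyclotomicExtension.isGalois {81} ℚ L
  have hcyc : IsCyclic (ZMod 81)ˣ := ZMod.isCyclic_units_of_prime_pow 3 Nat.prime_three (by norm_num) 4
  have htot : Nat.totient 81 = 54 := by decide
  exact ⟨IsCyclotomicExtension.Rat.isCMField L (S := ({81} : Set ℕ)) ⟨81, rfl, by norm_num⟩, inferInstance,
    (MulEquiv.isCyclic (IsCyclotomicExtension.autEquivPow L hirr)).2 hcyc,
    by rw [IsCyclotomicExtension.finrank L hirr, htot]⟩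

/-- **`ℚ(ζ₈₁)`: every simple abelian `27`-fold with complex multiplication by `ℚ(ζ₈₁)` has rank `28, 26, 22` or
`20`; rank `28` gives the Hodge conjecture for all its powers, the others carry a rational `(9,9)`- or
`(3,3)`-class outside the divisor classes.** [cite: Dodson1987, Prop. 4.4 (1) and Remark 4.5]
[cite: Hazama2003CyclicCM, Rem. 4.10] [cite: Gordon1999HodgeAVSurvey, Thm. 6.4 and 9.2.2] -/
theorem hodgeConjectureFor_pow_or_exceptional_eightyOne {L : Type} [Field L] [NumberField L]
    [IsCyclotomicExtension {81} ℚ L] (Φ : CMType L) {A : AbelianVariety ℂ} {ι : 𝓞 L →+* End A}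
    {θ : L →+* Module.End ℂ (complexBetti A.X 1)} (hA : IsCMTypeRealisation Φ A ι θ) (hs : A.IsSimple) :
    cmTypeRank Φ ∈ ({28, 26, 22, 20} : Finset ℕ) ∧
    ((cmTypeRank Φ = 28 ∧
      (∀ n m : ℕ, hodgeClassSpan (⨁ fun _ : Fin n => A).dim (⨁ fun _ : Fin n => A).X m =
        divisorClassesSpan (⨁ fun _ : Fin n => A).X (⨁ fun _ : Fin n => A).dim m) ∧
      ∀ n : ℕ, HodgeConjectureFor (⨁ fun _ : Fin n => A).dim (⨁ fun _ : Fin n => A).X) ∨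
    (cmTypeRank Φ ∈ ({26, 22, 20} : Finset ℕ) ∧
      ((∃ c : complexBetti A.X 18, IsRationalClass c ∧ IsOfHodgeType 27 A.X 18 9 9 c ∧
          c ∉ divisorClassesSpan A.X 27 9) ∨
        ∃ c : complexBetti A.X 6, IsRationalClass c ∧ IsOfHodgeType 27 A.X 6 3 3 c ∧
          c ∉ divisorClassesSpan A.X 27 3))) := by
  obtain ⟨hcm, hno, hcyc, hK⟩ := cm_normal_cyclic_finrank_eightyOne L
  haveI := hcm
  haveI := hno
  exact ⟨(cmTypeRank_mem_of_isCyclic_fiftyFour hcyc hK Φ hA).1 hs,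
    hodgeConjectureFor_pow_or_exceptional_of_isCyclic_fiftyFour hcyc hK Φ hA hs⟩

end TwentySeven

end CyclicPrimePower

end Literature.AlgebraicGeometry.Pohlmann1968
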